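import Literature.Probability.Percolation.ArmSeparationConvFour
import Literature.Probability.Percolation.ArmSeparationSepInitFour
import Literature.Probability.Percolation.ArmSeparationHalfStepBoundFour
import HarnessLib

/-!
# The well-separated four-arm event at bounded ratio, at `p`

Topic `Literature/Probability/Percolation`; family `crit-perc` / near-critical percolation on `𝕋`.
A brick of the near-critical arm-separation theorem for four arms of alternating colours
(P. Nolin, *Near-critical percolation in two dimensions*, EJP 13 (2008), Thm. 11 for `j = 4`,
`σ = BWBW` [arXiv 0711.4948: Thm. 10]; §4.3 Prop. 14, §4.4 first scale): for `2n ≤ N ≤ 256 n` the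
target event `sepFourArm n N` of the separation theorem (two disjoint open fenced arms landing on
the sides `0, 3`, two disjoint closed ones on the sides `1, 4`) has probability bounded below by a
constant, at a general parameter `p` with Russo–Seymour–Welsh inputs at `p` and `1 - p`: the explicit
fenced arm `sepInitArm` (extended along `sepOutCorrQ` when `N > 10 n`) read in the four ROTATION
frames `0, 1, 3, 4`; the four rotated supports lie in four pairwise disjoint half-open sectors, so
the four events are independent, and `sepFourArm_of_arms` (`ArmSeparationConvFour`) converts the four
arms into `sepFourArm`. Everything here is proved; no named facts are introduced.

## References

* P. Nolin, Near-critical percolation in two dimensions, *Electron. J. Probab.* 13 (2008), §4.3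
  Prop. 12 (proof), Prop. 14, §4.4 (arXiv 0711.4948: Prop. 11, Prop. 13, proof of Thm. 10) [Nolin2008].
-/

noncomputable section

open MeasureTheory Set

namespace Literature.Probability.Percolation

open LatticeModels

/-- **RSW and Harris for the explicit arm at `q`, cap on the box heights only** (the variant of
`le_real_sepInitArm_at` with `N ≤ 2 Ncap`: the five boxes have height `≤ N/4`): if
`c ≤ P_q(long-way crossing of [0, ⌊ρ k⌋] × [0, k])` for `1 ≤ k ≤ Ncap` (`ρ ≥ 1024`, `c ≥ 0`), then
`P_q(sepInitArm m N) ≥ c⁵` for `1100 ≤ m`, `2m ≤ N ≤ 10m`, `N ≤ 2 Ncap`. [cite: Nolin2008, §4.3 Prop. 14 (arXiv 0711.4948: Prop. 13)] -/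
theorem le_real_sepInitArm_at' (q : unitInterval) {c : ℝ} {ρ Ncap : ℕ}
    (hrsw : ∀ k : ℕ, 1 ≤ ⌊(ρ : ℝ) * k⌋₊ → k ≤ Ncap → c ≤ triLRCrossingProb q ⌊(ρ : ℝ) * k⌋₊ k)
    (hρ : 1024 ≤ ρ) (hc : 0 ≤ c) {m N : ℕ} (hm : 1100 ≤ m) (hmN : 2 * m ≤ N) (hN : N ≤ 10 * m) (hcap : N ≤ 2 * Ncap) :
    c ^ 5 ≤ (triSitePercolation q).real (sepInitArm m N) := by
  have hfl : ∀ k : ℕ, ⌊(ρ : ℝ) * (k : ℕ)⌋₊ = ρ * k := fun k => by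
    have : (ρ : ℝ) * (k : ℕ) = ((ρ * k : ℕ) : ℝ) := by push_cast; ring
    rw [this, Nat.floor_natCast]
  have hcw : ∀ L k : ℕ, 1 ≤ k → k ≤ Ncap → L ≤ 1024 * k → c ≤ triLRCrossingProb q L k := fun L k hk hkc hL => by
    have h := hrsw k (by rw [hfl]; nlinarith) hkc
    rw [hfl] at h
    exact h.trans (triLRCrossingProb_anti_width q (by nlinarith) k)
  set F := sepInitArmFinset m N with hF
  set E1 := triVCross ((m : ℤ) - (m / 8 : ℕ) + 1) (-((m / 2 : ℕ) : ℤ) - (m / 64 : ℕ)) (m / 8 - 2) (2 * (m / 64)) with hE1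
  set E2 := triHCross ((m : ℤ) - (m / 8 : ℕ) + 1) (-((m / 2 : ℕ) : ℤ)) (N - m + m / 8 - 2) (m / 64) with hE2
  set E3 := triVCross ((N : ℤ) - (N / 8 : ℕ)) (-((N / 2 : ℕ) : ℤ) - (N / 64 : ℕ)) (N / 8 - 1) (N / 2 + N / 64 - m / 2 + m / 64) with hE3
  set E4 := triHCross ((N : ℤ) - (N / 8 : ℕ)) (-((N / 2 : ℕ) : ℤ) - (N / 64 : ℕ) + 1) (2 * (N / 8) - 1) (N / 64 - 1) with hE4
  set E5 := triVCross ((N : ℤ) + 2) (-((N / 2 : ℕ) : ℤ) - (N / 64 : ℕ)) (N / 8 - 3) (2 * (N / 64)) with hE5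
  have c1 : (↑(triStripFinset ((m : ℤ) - (m / 8 : ℕ) + 1) (-((m / 2 : ℕ) : ℤ) - (m / 64 : ℕ)) (m / 8 - 2) (2 * (m / 64))) : Set (Site 2)) ⊆ ↑F :=
    Finset.coe_subset.2 (Finset.subset_union_left.trans (Finset.subset_union_left.trans
      (Finset.subset_union_left.trans Finset.subset_union_left)))
  have c2 : (↑(triStripFinset ((m : ℤ) - (m / 8 : ℕ) + 1) (-((m / 2 : ℕ) : ℤ)) (N - m + m / 8 - 2) (m / 64)) : Set (Site 2)) ⊆ ↑F :=
    Finset.coe_subset.2 (Finset.subset_union_right.trans (Finset.subset_union_left.trans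
      (Finset.subset_union_left.trans Finset.subset_union_left)))
  have c3 : (↑(triStripFinset ((N : ℤ) - (N / 8 : ℕ)) (-((N / 2 : ℕ) : ℤ) - (N / 64 : ℕ)) (N / 8 - 1) (N / 2 + N / 64 - m / 2 + m / 64)) :
      Set (Site 2)) ⊆ ↑F :=
    Finset.coe_subset.2 (Finset.subset_union_right.trans (Finset.subset_union_left.trans Finset.subset_union_left))
  have c4 : (↑(triStripFinset ((N : ℤ) - (N / 8 : ℕ)) (-((N / 2 : ℕ) : ℤ) - (N / 64 : ℕ) + 1) (2 * (N / 8) - 1) (N / 64 - 1)) : Set (Site 2)) ⊆ ↑F :=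
    Finset.coe_subset.2 (Finset.subset_union_right.trans Finset.subset_union_left)
  have c5 : (↑(triStripFinset ((N : ℤ) + 2) (-((N / 2 : ℕ) : ℤ) - (N / 64 : ℕ)) (N / 8 - 3) (2 * (N / 64))) : Set (Site 2)) ⊆ ↑F :=
    Finset.coe_subset.2 Finset.subset_union_right
  have d1 : DeterminedBy E1 ↑F := (determinedBy_triVCross _ _ _ _).mono c1
  have d2 : DeterminedBy E2 ↑F := (determinedBy_triHCross _ _ _ _).mono c2
  have d3 : DeterminedBy E3 ↑F := (determinedBy_triVCross _ _ _ _).mono c3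
  have d4 : DeterminedBy E4 ↑F := (determinedBy_triHCross _ _ _ _).mono c4
  have d5 : DeterminedBy E5 ↑F := (determinedBy_triVCross _ _ _ _).mono c5
  have u1 : IsUpperSet E1 := isUpperSet_triVCross _ _ _ _
  have u2 : IsUpperSet E2 := isUpperSet_triHCross _ _ _ _
  have u3 : IsUpperSet E3 := isUpperSet_triVCross _ _ _ _
  have u4 : IsUpperSet E4 := isUpperSet_triHCross _ _ _ _
  have u5 : IsUpperSet E5 := isUpperSet_triVCross _ _ _ _
  have e1 : c ≤ (triSitePercolation q).real E1 := by
    rw [hE1, triSitePercolation_real_triVCross]; exact hcw _ _ (by omega) (by omega) (by omega)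
  have e2 : c ≤ (triSitePercolation q).real E2 := by
    rw [hE2, triSitePercolation_real_triHCross]; exact hcw _ _ (by omega) (by omega) (by omega)
  have e3 : c ≤ (triSitePercolation q).real E3 := by
    rw [hE3, triSitePercolation_real_triVCross]; exact hcw _ _ (by omega) (by omega) (by omega)
  have e4 : c ≤ (triSitePercolation q).real E4 := by
    rw [hE4, triSitePercolation_real_triHCross]; exact hcw _ _ (by omega) (by omega) (by omega)
  have e5 : c ≤ (triSitePercolation q).real E5 := by
    rw [hE5, triSitePercolation_real_triVCross]; exact hcw _ _ (by omega) (by omega) (by omega)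
  have h12 := sitePercolation_harris q d1 d2 u1 u2
  have h123 := sitePercolation_harris q (d1.inter d2) d3 (u1.inter u2) u3
  have h1234 := sitePercolation_harris q ((d1.inter d2).inter d3) d4 ((u1.inter u2).inter u3) u4
  have h12345 := sitePercolation_harris q (((d1.inter d2).inter d3).inter d4) d5 (((u1.inter u2).inter u3).inter u4) u5
  have hdef : sepInitArm m N = E1 ∩ E2 ∩ E3 ∩ E4 ∩ E5 := rfl
  unfold triSitePercolation at e1 e2 e3 e4 e5 ⊢
  rw [hdef]
  set μ := sitePercolation (Site 2) q with hμ
  have h0 : ∀ s, 0 ≤ μ.real s := fun s => measureReal_nonneg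
  calc c ^ 5 = c * c * c * c * c := by ring
    _ ≤ μ.real E1 * μ.real E2 * μ.real E3 * μ.real E4 * μ.real E5 := by
        have := mul_le_mul e1 e2 hc (h0 _)
        have := mul_le_mul this e3 hc (mul_nonneg (h0 _) (h0 _))
        have := mul_le_mul this e4 hc (mul_nonneg (mul_nonneg (h0 _) (h0 _)) (h0 _))
        exact mul_le_mul this e5 hc (mul_nonneg (mul_nonneg (mul_nonneg (h0 _) (h0 _)) (h0 _)) (h0 _))
    _ ≤ μ.real (E1 ∩ E2) * μ.real E3 * μ.real E4 * μ.real E5 :=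
        mul_le_mul_of_nonneg_right (mul_le_mul_of_nonneg_right (mul_le_mul_of_nonneg_right h12 (h0 _)) (h0 _)) (h0 _)
    _ ≤ μ.real (E1 ∩ E2 ∩ E3) * μ.real E4 * μ.real E5 :=
        mul_le_mul_of_nonneg_right (mul_le_mul_of_nonneg_right h123 (h0 _)) (h0 _)
    _ ≤ μ.real (E1 ∩ E2 ∩ E3 ∩ E4) * μ.real E5 := mul_le_mul_of_nonneg_right h1234 (h0 _)
    _ ≤ μ.real (E1 ∩ E2 ∩ E3 ∩ E4 ∩ E5) := h12345

/-- The intermediate radius of the explicit arm at bounded ratio: `5n` up to the ratio `160`,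
`8n` beyond. [folklore] -/
def smallMid (n N : ℕ) : ℕ := if N ≤ 160 * n then 5 * n else 8 * n

/-- Bounds on the intermediate radius (`10 n < N ≤ 256 n`). [folklore] -/
theorem smallMid_bounds {n N : ℕ} (hN1 : 10 * n < N) (hN : N ≤ 256 * n) :
    2 * n ≤ smallMid n N ∧ smallMid n N ≤ 8 * n ∧ 2 * smallMid n N ≤ N ∧ N ≤ 32 * smallMid n N := by
  unfold smallMid; split_ifs with h <;> omega

/-- **The explicit fenced arm at bounded ratio**: `sepInitArm n N` for `N ≤ 10 n`, and
`sepInitArm n R ∩ sepOutCorrQ R N` (`R = smallMid n N ∈ {5n, 8n}`) for `10 n < N`. [cite: Nolin2008, §4.3 Prop. 12 (proof), Prop. 14 (arXiv 0711.4948: Prop. 11, Prop. 13)] -/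
def smallArm (n N : ℕ) : Set (SiteConfig (Site 2)) :=
  if N ≤ 10 * n then sepInitArm n N else sepInitArm n (smallMid n N) ∩ sepOutCorrQ (smallMid n N) N

/-- The sites of the explicit arm at bounded ratio. [folklore] -/
def smallArmFinset (n N : ℕ) : Finset (Site 2) :=
  if N ≤ 10 * n then sepInitArmFinset n N else sepInitArmFinset n (smallMid n N) ∪ sepOutCorrQFinset (smallMid n N) N

/-- The explicit arm is a fenced arm (`1100 ≤ n`, `2n ≤ N ≤ 256 n`). [cite: Nolin2008, §4.3 Prop. 12 (i) (arXiv 0711.4948: Prop. 11)] -/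
theorem smallArm_subset_sepOpenArm {n N : ℕ} (hn : 1100 ≤ n) (hnN : 2 * n ≤ N) (hN : N ≤ 256 * n) :
    smallArm n N ⊆ sepOpenArm n N := by
  unfold smallArm
  split_ifs with h
  · exact sepInitArm_subset_sepOpenArm hn hnN
  · obtain ⟨b1, b2, b3, b4⟩ := smallMid_bounds (not_le.1 h) hN
    rintro ω ⟨h1, h2⟩
    exact sepOpenArm_inter_sepOutCorrQ_subset (m := n) (R := smallMid n N) (R' := N) (by omega) (by omega) b3 b4
      ⟨sepInitArm_subset_sepOpenArm hn b1 h1, h2⟩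

/-- Locality of the explicit arm. [folklore] -/
theorem determinedBy_smallArm (n N : ℕ) : DeterminedBy (smallArm n N) ↑(smallArmFinset n N) := by
  unfold smallArm smallArmFinset
  split_ifs with h
  · exact determinedBy_sepInitArm n N
  · rw [Finset.coe_union]
    exact ((determinedBy_sepInitArm n (smallMid n N)).mono Set.subset_union_left).inter
      ((determinedBy_sepOutCorrQ (smallMid n N) N).mono Set.subset_union_right)

/-- The explicit arm is increasing. [folklore] -/
theorem isUpperSet_smallArm (n N : ℕ) : IsUpperSet (smallArm n N) := by
  unfold smallArm
  split_ifs with h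
  · exact isUpperSet_sepInitArm n N
  · exact (isUpperSet_sepInitArm n (smallMid n N)).inter (isUpperSet_sepOutCorrQ (smallMid n N) N)

/-- **The support of the explicit arm lies in the half-open sector of the right side**
`{x₁ ≤ 0 < x₀ + x₁}` (`1100 ≤ n`, `2n ≤ N ≤ 256 n`). [folklore] -/
theorem smallArmFinset_sector {n N : ℕ} (hn : 1100 ≤ n) (hnN : 2 * n ≤ N) (hN : N ≤ 256 * n) {v : Site 2}
    (hv : v ∈ smallArmFinset n N) : v 1 ≤ 0 ∧ 0 < v 0 + v 1 := by
  unfold smallArmFinset at hv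
  split_ifs at hv with h
  · have h' := sepInitArmFinset_cone (by omega) hnN hv; exact ⟨h'.1.le, h'.2⟩
  · obtain ⟨b1, b2, b3, b4⟩ := smallMid_bounds (not_le.1 h) hN
    rcases Finset.mem_union.1 hv with hv | hv
    · have h' := sepInitArmFinset_cone (m := n) (N := smallMid n N) (by omega) b1 hv; exact ⟨h'.1.le, h'.2⟩
    · have h' := sepOutCorrQFinset_subset (R := smallMid n N) (R' := N) (by omega) b3 b4 hv; exact ⟨h'.2.2.1, h'.2.2.2⟩

/-- **RSW and Harris for the explicit arm at `q`**: `P_q(smallArm n N) ≥ c^100` (RSW at `q` with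
aspect ratio `ρ ≥ 1024`, heights `≤ Ncap`; `1100 ≤ n`, `2n ≤ N ≤ 256 n`, `N ≤ 2 Ncap` — all boxes have
height `≤ N/4` —, `c ≤ 1`). [cite: Nolin2008, §4.3 Prop. 12 (proof), Prop. 14 (arXiv 0711.4948: Prop. 11, Prop. 13)] -/
theorem le_real_smallArm_at (q : unitInterval) {c : ℝ} {ρ Ncap : ℕ}
    (hrsw : ∀ k : ℕ, 1 ≤ ⌊(ρ : ℝ) * k⌋₊ → k ≤ Ncap → c ≤ triLRCrossingProb q ⌊(ρ : ℝ) * k⌋₊ k)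
    (hρ : 1024 ≤ ρ) (hc : 0 ≤ c) (hc1 : c ≤ 1) {n N : ℕ} (hn : 1100 ≤ n) (hnN : 2 * n ≤ N) (hN : N ≤ 256 * n) (hcap : N ≤ 2 * Ncap) :
    c ^ 100 ≤ (triSitePercolation q).real (smallArm n N) := by
  unfold smallArm
  split_ifs with h
  · calc c ^ 100 ≤ c ^ 5 := pow_le_pow_of_le_one hc hc1 (by norm_num)
      _ ≤ _ := le_real_sepInitArm_at' q hrsw hρ hc hn hnN h hcap
  · obtain ⟨b1, b2, b3, b4⟩ := smallMid_bounds (not_le.1 h) hN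
    have h1 := le_real_sepInitArm_at' q hrsw hρ hc (m := n) (N := smallMid n N) hn b1 (by omega) (by omega)
    have h2 := le_real_sepOutCorrQ_at' q hrsw (by omega) hc (R := smallMid n N) (R' := N) (by omega) b3 b4 hcap
    have har := sitePercolation_harris' q (determinedBy_sepInitArm n (smallMid n N)) (determinedBy_sepOutCorrQ (smallMid n N) N)
      (isUpperSet_sepInitArm n (smallMid n N)) (isUpperSet_sepOutCorrQ (smallMid n N) N)
    unfold triSitePercolation at h1 h2 ⊢
    calc c ^ 100 = c ^ 5 * c ^ 95 := by ring
      _ ≤ _ := (mul_le_mul h1 h2 (pow_nonneg hc _) measureReal_nonneg).trans har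

/-- **The well-separated four-arm event at bounded ratio, at `p`**: with the RSW input `hrsw` at
`p` and at `1 - p` (aspect ratio `ρ ≥ 1024`, heights `≤ Ncap`), `P_p(sepFourArm n N) ≥ (c^100)⁴` for
`1100 ≤ n`, `2n ≤ N ≤ 256 n`, `N ≤ 2 Ncap`, `c ≤ 1`: the explicit arm read in the four rotation frames
`0, 3` (open) and `1, 4` (closed) — independent, since the four rotated supports lie in the pairwise
disjoint half-open sectors —, and `sepFourArm_of_arms`. [cite: Nolin2008, §4.3 Prop. 14, §4.4 (arXiv 0711.4948: Prop. 13; proof of Thm. 10, first scale)] -/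
theorem pow_le_real_sepFourArm_smallRatio_at (p : unitInterval) {c : ℝ} {ρ Ncap : ℕ}
    (hrsw : ∀ q : unitInterval, (q = p ∨ q = unitInterval.symm p) →
      ∀ k : ℕ, 1 ≤ ⌊(ρ : ℝ) * k⌋₊ → k ≤ Ncap → c ≤ triLRCrossingProb q ⌊(ρ : ℝ) * k⌋₊ k)
    (hρ : 1024 ≤ ρ) (hc : 0 ≤ c) (hc1 : c ≤ 1) {n N : ℕ} (hn : 1100 ≤ n) (hnN : 2 * n ≤ N) (hN : N ≤ 256 * n) (hcap : N ≤ 2 * Ncap) :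
    (c ^ 100) ^ 4 ≤ (triSitePercolation p).real (sepFourArm n N) := by
  classical
  set A := smallArm n N with hA
  set F := smallArmFinset n N with hF
  have dA : DeterminedBy A ↑F := determinedBy_smallArm n N
  have huA : IsUpperSet A := isUpperSet_smallArm n N
  have dAr : ∀ i, DeterminedBy (rotConfig i ⁻¹' A) ↑(F.image (triRotIsoPow i)) := fun i => by
    rw [Finset.coe_image]; exact determinedBy_preimage_rotConfig i dA
  have dArc : ∀ i, DeterminedBy {ω : SiteConfig (Site 2) | rotConfig i ωᶜ ∈ A} ↑(F.image (triRotIsoPow i)) := fun i => by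
    have h2 : {ω : SiteConfig (Site 2) | rotConfig i ωᶜ ∈ A} = {ω : SiteConfig (Site 2) | ωᶜ ∈ rotConfig i ⁻¹' A} := by
      ext ω; simp only [Set.mem_setOf_eq, Set.mem_preimage]
    rw [h2]; exact DeterminedBy.preimage_compl' (dAr i)
  have sec := fun {v : Site 2} (hv : v ∈ F) => smallArmFinset_sector hn hnN hN hv
  -- pairwise disjointness of the rotated supports (sectors 0, 1, 3, 4)
  have disj : ∀ i j : ℕ, i ≠ j → (i = 0 ∨ i = 1 ∨ i = 3 ∨ i = 4) → (j = 0 ∨ j = 1 ∨ j = 3 ∨ j = 4) →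
      Disjoint (F.image (triRotIsoPow i)) (F.image (triRotIsoPow j)) := by
    intro i j hij hi hj
    rw [Finset.disjoint_left]
    intro v hv hv'
    rw [Finset.mem_image] at hv hv'
    obtain ⟨u, hu, rfl⟩ := hv
    obtain ⟨w, hw, huw⟩ := hv'
    have cu := sec hu
    have cw := sec hw
    obtain ⟨u00, u01, u10, u11, -, -, u30, u31, u40, u41, -⟩ := rot_apply_formula u
    obtain ⟨w00, w01, w10, w11, -, -, w30, w31, w40, w41, -⟩ := rot_apply_formula w
    have e0 := congrFun huw 0
    have e1 := congrFun huw 1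
    rcases hi with rfl | rfl | rfl | rfl <;> rcases hj with rfl | rfl | rfl | rfl <;>
      first
        | exact absurd rfl hij
        | (simp only [u00, u01, u10, u11, u30, u31, u40, u41, w00, w01, w10, w11, w30, w31, w40, w41] at e0 e1; omega)
  -- probabilities of the four rotated events
  have h100 : ∀ q : unitInterval, (q = p ∨ q = unitInterval.symm p) → c ^ 100 ≤ (triSitePercolation q).real A :=
    fun q hq => le_real_smallArm_at q (hrsw q hq) hρ hc hc1 hn hnN hN hcap
  have ro : ∀ i, (triSitePercolation p).real (rotConfig i ⁻¹' A) = (triSitePercolation p).real A := fun i => real_preimage_rotConfig p i A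
  have rc : ∀ i, (triSitePercolation p).real {ω : SiteConfig (Site 2) | rotConfig i ωᶜ ∈ A} = (triSitePercolation (unitInterval.symm p)).real A :=
    fun i => by
      have h2 : {ω : SiteConfig (Site 2) | rotConfig i ωᶜ ∈ A} = compl ⁻¹' (rotConfig i ⁻¹' A) := by
        ext ω; simp only [Set.mem_setOf_eq, Set.mem_preimage]
      rw [h2]
      unfold triSitePercolation
      rw [sitePercolation_real_preimage_compl]
      exact real_preimage_rotConfig (unitInterval.symm p) i A
  -- independence
  have i01 := sitePercolation_real_inter_of_disjoint p (dAr 0) (dArc 1) (disj 0 1 (by norm_num) (Or.inl rfl) (Or.inr (Or.inl rfl)))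
  have d01 : DeterminedBy (rotConfig 0 ⁻¹' A ∩ {ω : SiteConfig (Site 2) | rotConfig 1 ωᶜ ∈ A}) ↑(F.image (triRotIsoPow 0) ∪ F.image (triRotIsoPow 1)) := by
    rw [Finset.coe_union]
    exact ((dAr 0).mono Set.subset_union_left).inter ((dArc 1).mono Set.subset_union_right)
  have i013 := sitePercolation_real_inter_of_disjoint p d01 (dAr 3)
    (Finset.disjoint_union_left.2 ⟨disj 0 3 (by norm_num) (Or.inl rfl) (Or.inr (Or.inr (Or.inl rfl))),
      disj 1 3 (by norm_num) (Or.inr (Or.inl rfl)) (Or.inr (Or.inr (Or.inl rfl)))⟩)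
  have d013 : DeterminedBy (rotConfig 0 ⁻¹' A ∩ {ω : SiteConfig (Site 2) | rotConfig 1 ωᶜ ∈ A} ∩ rotConfig 3 ⁻¹' A)
      ↑(F.image (triRotIsoPow 0) ∪ F.image (triRotIsoPow 1) ∪ F.image (triRotIsoPow 3)) := by
    rw [Finset.coe_union]
    exact (d01.mono Set.subset_union_left).inter ((dAr 3).mono Set.subset_union_right)
  have i0134 := sitePercolation_real_inter_of_disjoint p d013 (dArc 4)
    (Finset.disjoint_union_left.2 ⟨Finset.disjoint_union_left.2
      ⟨disj 0 4 (by norm_num) (Or.inl rfl) (Or.inr (Or.inr (Or.inr rfl))), disj 1 4 (by norm_num) (Or.inr (Or.inl rfl)) (Or.inr (Or.inr (Or.inr rfl)))⟩,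
      disj 3 4 (by norm_num) (Or.inr (Or.inr (Or.inl rfl))) (Or.inr (Or.inr (Or.inr rfl)))⟩)
  have hsub : rotConfig 0 ⁻¹' A ∩ {ω : SiteConfig (Site 2) | rotConfig 1 ωᶜ ∈ A} ∩ rotConfig 3 ⁻¹' A ∩ {ω | rotConfig 4 ωᶜ ∈ A} ⊆
      sepFourArm n N := by
    rintro ω ⟨⟨⟨h0, h1⟩, h3⟩, h4⟩
    have hs := smallArm_subset_sepOpenArm hn hnN hN
    exact sepFourArm_of_arms (by omega) hnN (hs h0) (hs h3) (hs h1) (hs h4)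
  have hp := h100 p (Or.inl rfl)
  have hq := h100 (unitInterval.symm p) (Or.inr rfl)
  have hK : 0 ≤ c ^ 100 := pow_nonneg hc _
  unfold triSitePercolation at ro rc hp hq i01 i013 i0134 ⊢
  calc (c ^ 100) ^ 4 = c ^ 100 * c ^ 100 * c ^ 100 * c ^ 100 := by ring
    _ ≤ (sitePercolation (Site 2) p).real (rotConfig 0 ⁻¹' A) * (sitePercolation (Site 2) p).real {ω : SiteConfig (Site 2) | rotConfig 1 ωᶜ ∈ A} *
          (sitePercolation (Site 2) p).real (rotConfig 3 ⁻¹' A) * (sitePercolation (Site 2) p).real {ω : SiteConfig (Site 2) | rotConfig 4 ωᶜ ∈ A} := by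
        rw [ro 0, rc 1, ro 3, rc 4]
        have h0 : ∀ s, 0 ≤ (sitePercolation (Site 2) p).real s := fun s => measureReal_nonneg
        have h0' : ∀ s, 0 ≤ (sitePercolation (Site 2) (unitInterval.symm p)).real s := fun s => measureReal_nonneg
        have t2 := mul_le_mul hp hq hK (h0 _)
        have t3 := mul_le_mul t2 hp hK (mul_nonneg (h0 _) (h0' _))
        exact mul_le_mul t3 hq hK (mul_nonneg (mul_nonneg (h0 _) (h0' _)) (h0 _))
    _ = (sitePercolation (Site 2) p).real (rotConfig 0 ⁻¹' A ∩ {ω : SiteConfig (Site 2) | rotConfig 1 ωᶜ ∈ A} ∩ rotConfig 3 ⁻¹' A ∩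
          {ω | rotConfig 4 ωᶜ ∈ A}) := by rw [i0134, i013, i01]
    _ ≤ (sitePercolation (Site 2) p).real (sepFourArm n N) := measureReal_mono hsub (measure_ne_top _ _)

end Literature.Probability.Percolation
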